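import Summits.QuantumFields.YangMills.Theorems.CoarseStiffnessTailCappedCoarseStiffnessLTotalLogSlack
import Summits.QuantumFields.YangMills.Theorems.CoarseStiffnessTailCappedCoarseStiffnessLSharpUpperBound
import Summits.QuantumFields.YangMills.Theorems.CoarseStiffnessTailCappedCoarseStiffnessLSharpLowerBound
import Summits.QuantumFields.YangMills.Theorems.CoarseStiffnessTailCappedCoarseStiffnessLCommVolumeUpper
import Summits.QuantumFields.YangMills.Theorems.CoarseStiffnessTailCappedCoarseStiffnessLCommVolumeLower
import Summits.QuantumFields.YangMills.Theorems.BalabanUVNodesN13WilsonPartitionFnAxialTreeUpperBound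

/-!
# Route `CoarseStiffnessTail` — STUB S3 OF THE BIRTH SKELETON OF `CappedCoarseStiffnessL` (25301): THE UNIFORM MEAN ACTION
# `β_K·∫ Σ_a|U(∂a) − 1|² dGibbs_K ≤ C·#Plaq_0` FOR ALL COUPLINGS `γ ≤ 1`, ALL VOLUMES, ALL CUT-OFFS
# (lead's certificate, seat `ym-line-cst-p1` g15; proves the registered stub `stub_uniformMeanAction` BY NAME AND SIGNATURE, P2/(W4))

THE THEOREM (`stub_uniformMeanAction`, verbatim the registered stub of `Cruxes/CappedCoarseStiffnessL/Lines/birth.lean`): for every `L` there are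
`C` and `γ₁ = 1` such that for every three-torus family `F` with `F.L = L`, every `0 < γ ≤ 1` and every cut-off `K`,
`β_K·∫ Σ_{a ∈ Plaq_0}|U(∂a) − 1|² dGibbs_K ≤ C·#Plaq_0`, `β_K = (γL^{−K})⁻¹` — the mean plaquette energy is `O(1/β_K)` uniformly in the volume,
the cut-off AND the coupling, including the hyper-weak corner `log β_K > #Plaq_0` that `…LTotalLogSlack` left open.

PROOF: THE EXACT LAPLACE EXPONENT OF THE TORUS PARTITION FUNCTION.  For `G = SU(2)`, `d = 3`, every torus `P` (`|T|` sites, `n` per direction):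
* UPPER (`log_partitionFn_le_exact`): `Z_P(β) ≤ linkMass(β/2)^{2(|T|−1)}·J₃(β/(4n²·3))` (`…LSharpUpperBound`), `log linkMass(b) ≤ −(3/2)log b + log(DT)`
  (`N13…GaussianUpperBoundSU`), `J₃(s) ≤ C_J/s²` (`…LCommVolumeUpper`) ⇒ `log Z_P(β) ≤ −(3|T|−1)·log β + A·|T|`.
* LOWER (`log_partitionFn_ge_exact`): `Z_P(β) ≥ e^{−(25/2)·9|T|}·haar(B_τ)^{2(|T|−1)}·Haar³(Comm_τ)`, `τ = β^{−1/2}` (`…LSharpLowerBound`),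
  `log haar(B_τ) ≥ 3 log τ − c` (`N13…GaugeFixedLowerBound`), `Haar³(Comm_τ) ≥ c_W τ⁴` (`…LCommVolumeLower`) ⇒ `log Z_P(β) ≥ −(3|T|−1)·log β − B·|T|`.
* RATIO (`log_partitionFn_ratio_le_exact`): for `1 ≤ β ≤ 2β'`: `log Z_P(β') − log Z_P(β) ≤ (A + B + 3 log 2)·|T|` — NO `log β` slack.
* MEAN ACTION (`exists_bareStiffness_le`, `exists_meanSqSum_le`): `∫e^{c₀β_KΣ|U(∂a)−1|²}dGibbs_K ≤ Z((1−4c₀)β_K)/Z(β_K) ≤ e^{E·#Plaq_0}`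
  (`Σ|U(∂a)−1|² ≤ 4·A(U)`, `…LPressureConvexity`), and Jensen at `c₀ = 1/8`.

HONEST SCOPE.  This closes stub S3 of the line (a classical statement about the bare Wilson action on Bałaban's three-tori); stubs S1/S2 (the
renormalisation-group content: EDGE-deep large-field count, BULK-deep sub-threshold stiffness) and hence the crux 25301, `HistoryTailL` 19936 and
`YM3TorusSU2` (R3, RECORD rung, not Clay) stay OPEN; the Yang–Mills mass gap is NOT touched.

References: T. Bałaban, CMP **102** (1985) 255–275 [Balaban1985UV3] ((5) p.256, (11) p.258, p.260); [folklore] (exact Laplace exponents of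
lattice gauge partition functions; almost-commuting tuples).
-/

noncomputable section

open MeasureTheory ProbabilityTheory Finset
open scoped BigOperators

namespace Summit.QuantumFields.YangMills.Theorems.CoarseStiffnessTailUniformMeanAction

open Literature.MathematicalPhysics.QuantumFieldTheory
open Literature.MathematicalPhysics.QuantumFieldTheory.UnitaryCayley (haarChartConst)
open Literature.MathematicalPhysics.QuantumFieldTheory.Balaban1983to89
open Literature.MathematicalPhysics.QuantumFieldTheory.Balaban1983to89.T3ContinuumYM3Torus
open Literature.MathematicalPhysics.QuantumFieldTheory.Balaban1983to89.T3UnitScaleTilt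
open Literature.MathematicalPhysics.QuantumFieldTheory.Balaban1983to89.T3UnitLawDensityEML
open Literature.MathematicalPhysics.QuantumFieldTheory.Balaban1983to89.Missing
open Literature.MathematicalPhysics.QuantumFieldTheory.Balaban1983to89.B16ZLower
open Literature.MathematicalPhysics.QuantumFieldTheory.Balaban1983to89.T4StabilityFloorUnitary
open Literature.MathematicalPhysics.QuantumFieldTheory.Balaban1983to89.T3UpperLiftSplit (scheme_β_eq)
open Summit.QuantumFields.BalabanUV.T4Continuum.NE7b.BarePartitionFnDecay (linkMass linkMass_nonneg)
open Summit.QuantumFields.YangMills.BalabanUVNodes.N13ZNormLaplaceUpperSU (one_le_DT)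
open Summit.QuantumFields.YangMills.BalabanUVNodes.N13WilsonPartitionFnGaussianUpperBoundSU (log_linkMass_SU_le)
open Summit.QuantumFields.YangMills.BalabanUVNodes.N13WilsonPartitionFnGaugeFixedLowerBound (log_haarReal_suOpBall_ge)
open Summit.QuantumFields.YangMills.BalabanUVNodes.N13WilsonPartitionFnAxialTreeUpperBound (linkMass_pos)
open Summit.QuantumFields.YangMills.Theorems.CoarseStiffnessTailPressureConvexity
open Summit.QuantumFields.YangMills.Theorems.CoarseStiffnessTailBareCompactCoupling (card_plaq_zero_eq)
open Summit.QuantumFields.YangMills.Theorems.CoarseStiffnessTailSharpUpperBound (partitionFn_le_cornerComb_mul_cycleIntegral)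
open Summit.QuantumFields.YangMills.Theorems.CoarseStiffnessTailSharpLowerBound (partitionFn_ge_commBox)
open Summit.QuantumFields.YangMills.Theorems.CoarseStiffnessTailCommVolumeUpper (integral_boltz_le_of_eq_three)
open Summit.QuantumFields.YangMills.Theorems.CoarseStiffnessTailCommVolumeLower (haar_commBox_ge_of_eq_three)

/-! ## §1 Counting on a three-dimensional torus -/

section Counting

/-- Three pairs `k < l` in three dimensions. [folklore] -/
theorem card_pairs_eq_three : ∀ n : ℕ, n = 3 →
    ((Finset.univ : Finset (Fin n × Fin n)).filter fun t => t.1 < t.2).card = 3 := by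
  rintro n rfl
  decide

/-- `n ≤ |T| = n^d` sites. [folklore] -/
theorem sitesPerDir_le_card_site (P : Params) : (P.sitesPerDir 0 : ℝ) ≤ (Fintype.card (Site P 0) : ℝ) := by
  rw [Site.card_site P 0]
  exact_mod_cast Nat.le_self_pow (by have := P.hd; omega) (P.sitesPerDir 0)

/-- `1 ≤ n`. [folklore] -/
theorem one_le_sitesPerDir (P : Params) : (1 : ℝ) ≤ (P.sitesPerDir 0 : ℝ) := by
  have h1 : 0 < P.sitesPerDir 0 := by
    unfold Params.sitesPerDir
    have := P.L_pos
    positivity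
  exact_mod_cast h1

end Counting

/-! ## §2 The exact Laplace exponent `−(3|T| − 1)·log β` of `Z_P(β)` on three-tori, `G = SU(2)` -/

section Exponent

/-- **UPPER**: `∃ A, ∀ P (d = 3), ∀ β > 0: log Z_P(β) ≤ −(3|T|−1)·log β + A·|T|`. [folklore] -/
theorem log_partitionFn_le_exact :
    ∃ A : ℝ, ∀ (P : Params), P.d = 3 → ∀ β : ℝ, 0 < β →
      Real.log (partitionFn (G := Matrix.specialUnitaryGroup (Fin 2) ℂ) P β) ≤
        -(3 * (Fintype.card (Site P 0) : ℝ) - 1) * Real.log β + A * (Fintype.card (Site P 0) : ℝ) := by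
  obtain ⟨CJ, hCJ, hJ⟩ := integral_boltz_le_of_eq_three
  set LDT : ℝ := Real.log (max (Real.pi * (haarChartConst 2 : ℝ) * 5 ^ (2 * 2) *
        (volume (Metric.closedBall (0 : EuclideanSpace ℝ (Fin 2 × Fin 2)) 1)).toReal) (10 ^ (2 * 2 - 1)) *
      (∑' k : ℕ, ((k : ℝ) + 1) ^ (2 * 2 - 1) * Real.exp (-(1 / (2 * ((2 : ℕ) : ℝ)))) ^ k)) with hLDT
  have hLDT0 : 0 ≤ LDT := by rw [hLDT]; exact Real.log_nonneg one_le_DT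
  refine ⟨3 * Real.log 2 + 2 * LDT + |Real.log CJ| + 2 * Real.log 36 + 4, fun P hd β hβ => ?_⟩
  -- letters
  set V : ℝ := (Fintype.card (Site P 0) : ℝ) with hV
  set n : ℝ := (P.sitesPerDir 0 : ℝ) with hn
  have hV1 : 1 ≤ V := by rw [hV]; exact_mod_cast (Fintype.card_pos : 0 < Fintype.card (Site P 0))
  have hn1 : 1 ≤ n := by rw [hn]; exact one_le_sitesPerDir P
  have hnV : n ≤ V := sitesPerDir_le_card_site P
  have hpairs : ((Finset.univ.filter fun kl : Fin P.d × Fin P.d => kl.1 < kl.2).card : ℝ) = 3 := by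
    exact_mod_cast card_pairs_eq_three P.d hd
  -- the rate of the cycle integral
  obtain ⟨s, hs⟩ : ∃ s : ℝ, s = β / (2 * (((2 : ℕ) : ℝ) * ((P.sitesPerDir 0 : ℝ) * (P.sitesPerDir 0 : ℝ)) *
      ((Finset.univ.filter fun kl : Fin P.d × Fin P.d => kl.1 < kl.2).card : ℝ))) := ⟨_, rfl⟩
  have hs' : s = β / (12 * n ^ 2) := by rw [hs, hpairs, hn]; push_cast; ring
  have hs0 : 0 < s := by rw [hs']; positivity
  -- R4 + W2
  have hR4 := partitionFn_le_cornerComb_mul_cycleIntegral 2 P hβ.le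
  rw [← hs] at hR4
  have hW2 := hJ P.d hd s hs0
  set lM : ℝ := linkMass (G := Matrix.specialUnitaryGroup (Fin 2) ℂ) (β / 2) with hlM
  have hlM0 : 0 < lM := linkMass_pos _
  have hZ : 0 < partitionFn (G := Matrix.specialUnitaryGroup (Fin 2) ℂ) P β := partitionFn_pos' P hβ.le
  have he : (((P.d - 1) * (Fintype.card (Site P 0) - 1) : ℕ) : ℝ) = 2 * (V - 1) := by
    have hT : 1 ≤ Fintype.card (Site P 0) := Fintype.card_pos
    rw [Nat.cast_mul, Nat.cast_sub P.hd, Nat.cast_sub hT, hd, hV]; norm_num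
  have hZle : partitionFn (G := Matrix.specialUnitaryGroup (Fin 2) ℂ) P β ≤
      lM ^ ((P.d - 1) * (Fintype.card (Site P 0) - 1)) * (CJ / s ^ 2) :=
    hR4.trans (mul_le_mul_of_nonneg_left hW2 (pow_nonneg hlM0.le _))
  have hlog := Real.log_le_log hZ hZle
  rw [Real.log_mul (pow_ne_zero _ hlM0.ne') (by positivity), Real.log_pow, he, Real.log_div hCJ.ne' (by positivity),
    Real.log_pow] at hlog
  -- the pieces
  have hlM_le : Real.log lM ≤ -(3 / 2) * (Real.log β - Real.log 2) + LDT := by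
    have h := log_linkMass_SU_le 2 (by positivity : (0 : ℝ) < β / 2)
    rw [← hLDT, Real.log_div hβ.ne' two_ne_zero] at h
    have ha : -((((2 * 2 : ℕ) : ℝ) - 1) / 2) = -(3 / 2 : ℝ) := by norm_num
    rw [ha] at h
    exact h
  have hlogs : -Real.log s ≤ -Real.log β + Real.log 36 + 2 * V := by
    rw [hs', Real.log_div hβ.ne' (by positivity), Real.log_mul (by norm_num) (by positivity), Real.log_pow]
    have h36 : Real.log 12 ≤ Real.log 36 := Real.log_le_log (by norm_num) (by norm_num)
    have hlogn : Real.log n ≤ V := by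
      have := Real.log_le_sub_one_of_pos (by linarith : 0 < n); linarith
    push_cast
    linarith
  have hlog2 : 0 ≤ Real.log 2 := Real.log_nonneg (by norm_num)
  have hlog36 : 0 ≤ Real.log 36 := Real.log_nonneg (by norm_num)
  have hCJabs : Real.log CJ ≤ |Real.log CJ| := le_abs_self _
  have hcoef : 0 ≤ 2 * (V - 1) := by linarith
  have h1 : 2 * (V - 1) * Real.log lM ≤ 2 * (V - 1) * (-(3 / 2) * (Real.log β - Real.log 2) + LDT) :=
    mul_le_mul_of_nonneg_left hlM_le hcoef
  -- assemble
  have key : 2 * (V - 1) * (-(3 / 2) * (Real.log β - Real.log 2) + LDT) + Real.log CJ + 2 * (-Real.log β + Real.log 36 + 2 * V) ≤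
      -(3 * V - 1) * Real.log β + (3 * Real.log 2 + 2 * LDT + |Real.log CJ| + 2 * Real.log 36 + 4) * V := by
    nlinarith [mul_nonneg hLDT0 (by linarith : (0:ℝ) ≤ V - 1), mul_nonneg hlog2 (by linarith : (0:ℝ) ≤ V - 1),
      mul_nonneg (abs_nonneg (Real.log CJ)) (by linarith : (0:ℝ) ≤ V - 1), mul_nonneg hlog36 (by linarith : (0:ℝ) ≤ V - 1)]
  have : ((2 : ℕ) : ℝ) * Real.log s = 2 * Real.log s := by norm_num
  rw [this] at hlog
  linarith [hlog, h1, hlogs, key]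

/-- **LOWER**: `∃ B, ∀ P (d = 3), ∀ β ≥ 1: −(3|T|−1)·log β − B·|T| ≤ log Z_P(β)`. [folklore] -/
theorem log_partitionFn_ge_exact :
    ∃ B : ℝ, ∀ (P : Params), P.d = 3 → ∀ β : ℝ, 1 ≤ β →
      -(3 * (Fintype.card (Site P 0) : ℝ) - 1) * Real.log β - B * (Fintype.card (Site P 0) : ℝ) ≤
        Real.log (partitionFn (G := Matrix.specialUnitaryGroup (Fin 2) ℂ) P β) := by
  obtain ⟨cW, hcW, hW⟩ := haar_commBox_ge_of_eq_three
  set ch : ℝ := ((2 * 2 : ℕ) : ℝ) * Real.log (16 * Real.pi + 1) + Real.log ((2 * ((2 : ℕ) : ℝ) + 1) / (4 * Real.pi)) with hch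
  refine ⟨225 / 2 + 2 * |ch| + |Real.log cW|, fun P hd β hβ1 => ?_⟩
  set V : ℝ := (Fintype.card (Site P 0) : ℝ) with hV
  have hV1 : 1 ≤ V := by rw [hV]; exact_mod_cast (Fintype.card_pos : 0 < Fintype.card (Site P 0))
  have hβ0 : 0 < β := by linarith
  -- `τ = β^{−1/2} ∈ (0, 1]`
  set τ : ℝ := (Real.sqrt β)⁻¹ with hτ
  have hsq : 0 < Real.sqrt β := Real.sqrt_pos.2 hβ0
  have hτ0 : 0 < τ := by rw [hτ]; positivity
  have hτ1 : τ ≤ 1 := by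
    rw [hτ]; exact inv_le_one_of_one_le₀ (Real.one_le_sqrt.2 hβ1)
  have hlogτ : Real.log τ = -(1 / 2) * Real.log β := by
    rw [hτ, Real.log_inv, Real.log_sqrt hβ0.le]; ring
  -- R5 + W3 + the ball
  have hR5 := partitionFn_ge_commBox 2 P hβ1
  have hW3 := hW P.d hd τ hτ0 hτ1
  set h : ℝ := (HaarData.haar : Measure (Matrix.specialUnitaryGroup (Fin 2) ℂ)).real (suOpBall 2 (Real.sqrt β)⁻¹) with hh
  set H : ℝ := (Measure.pi fun _ : Fin P.d => (HaarData.haar : Measure (Matrix.specialUnitaryGroup (Fin 2) ℂ))).real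
      {a | ∀ k l : Fin P.d, dist1 (a k * a l * (a k)⁻¹ * (a l)⁻¹) ≤ (Real.sqrt β)⁻¹} with hH
  have hh0 : 0 < h := haarReal_suOpBall_pos (N := 2) hτ0
  have hH0 : 0 < H := lt_of_lt_of_le (by positivity) hW3
  have hZ : 0 < partitionFn (G := Matrix.specialUnitaryGroup (Fin 2) ℂ) P β := partitionFn_pos' P hβ0.le
  have he : (((P.d - 1) * (Fintype.card (Site P 0) - 1) : ℕ) : ℝ) = 2 * (V - 1) := by
    have hT : 1 ≤ Fintype.card (Site P 0) := Fintype.card_pos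
    rw [Nat.cast_mul, Nat.cast_sub P.hd, Nat.cast_sub hT, hd, hV]; norm_num
  have hlow : Real.exp (-(25 / 2 * (P.d : ℝ) ^ 2 * (Fintype.card (Site P 0) : ℝ))) *
      h ^ ((P.d - 1) * (Fintype.card (Site P 0) - 1)) * (cW * τ ^ 4) ≤
      partitionFn (G := Matrix.specialUnitaryGroup (Fin 2) ℂ) P β :=
    (mul_le_mul_of_nonneg_left hW3 (by positivity)).trans hR5
  have hlog := Real.log_le_log (by positivity) hlow
  rw [Real.log_mul (by positivity) (by positivity), Real.log_mul (by positivity) (by positivity), Real.log_exp, Real.log_pow, he,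
    Real.log_mul hcW.ne' (by positivity), Real.log_pow, hlogτ] at hlog
  have hd3 : (P.d : ℝ) = 3 := by exact_mod_cast hd
  rw [hd3] at hlog
  -- the ball
  have hball : 3 * Real.log τ - ch ≤ Real.log h := by
    have hb := log_haarReal_suOpBall_ge 2 hτ0 hτ1
    rw [← hch] at hb
    have h3 : (((2 * 2 : ℕ) : ℝ) - 1) = 3 := by norm_num
    rw [h3] at hb
    exact hb
  rw [hlogτ] at hball
  have hcoef : 0 ≤ 2 * (V - 1) := by linarith
  have h1 : 2 * (V - 1) * (3 * (-(1 / 2) * Real.log β) - ch) ≤ 2 * (V - 1) * Real.log h := mul_le_mul_of_nonneg_left hball hcoef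
  have hchabs : -ch ≤ |ch| := neg_le_abs _
  have hchabs' : ch ≤ |ch| := le_abs_self _
  have hcWabs : -Real.log cW ≤ |Real.log cW| := neg_le_abs _
  have key : -(3 * V - 1) * Real.log β - (225 / 2 + 2 * |ch| + |Real.log cW|) * V ≤
      -(25 / 2 * (3 : ℝ) ^ 2 * V) + 2 * (V - 1) * (3 * (-(1 / 2) * Real.log β) - ch) + (Real.log cW + ((4 : ℕ) : ℝ) * (-(1 / 2) * Real.log β)) := by
    push_cast
    nlinarith [mul_nonneg (abs_nonneg ch) (by linarith : (0:ℝ) ≤ V - 1), abs_nonneg (Real.log cW), mul_nonneg (abs_nonneg (Real.log cW)) (by linarith : (0:ℝ) ≤ V - 1)]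
  linarith [hlog, h1, key]

/-- **★ THE PARTITION RATIO WITH NO LOGARITHMIC SLACK** (`G = SU(2)`, `d = 3`, `1 ≤ β`, `0 < β'`, `β ≤ 2β'`):
`log Z_P(β') − log Z_P(β) ≤ E·|T|`. [folklore] -/
theorem log_partitionFn_ratio_le_exact :
    ∃ E : ℝ, 0 ≤ E ∧ ∀ (P : Params), P.d = 3 → ∀ β β' : ℝ, 1 ≤ β → 0 < β' → β ≤ 2 * β' →
      Real.log (partitionFn (G := Matrix.specialUnitaryGroup (Fin 2) ℂ) P β') -
          Real.log (partitionFn (G := Matrix.specialUnitaryGroup (Fin 2) ℂ) P β) ≤ E * (Fintype.card (Site P 0) : ℝ) := by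
  obtain ⟨A, hA⟩ := log_partitionFn_le_exact
  obtain ⟨B, hB⟩ := log_partitionFn_ge_exact
  refine ⟨max (A + B + 3 * Real.log 2) 0, le_max_right _ _, fun P hd β β' hβ hβ' hββ' => ?_⟩
  set V : ℝ := (Fintype.card (Site P 0) : ℝ) with hV
  have hV1 : 1 ≤ V := by rw [hV]; exact_mod_cast (Fintype.card_pos : 0 < Fintype.card (Site P 0))
  have hU := hA P hd β' hβ'
  have hL := hB P hd β hβ
  have hlog2 : Real.log β - Real.log β' ≤ Real.log 2 := by
    have := Real.log_le_log (by linarith) hββ'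
    rw [Real.log_mul two_ne_zero hβ'.ne'] at this
    linarith
  have h3V : 0 ≤ 3 * V - 1 := by linarith
  have h1 : (3 * V - 1) * (Real.log β - Real.log β') ≤ (3 * V - 1) * Real.log 2 := mul_le_mul_of_nonneg_left hlog2 h3V
  have hmax : (A + B + 3 * Real.log 2) * V ≤ max (A + B + 3 * Real.log 2) 0 * V :=
    mul_le_mul_of_nonneg_right (le_max_left _ _) (by linarith)
  have hl2 : 0 ≤ Real.log 2 := Real.log_nonneg (by norm_num)
  nlinarith [hU, hL, h1, hmax, hl2]

end Exponent

/-! ## §3 The mean action on Bałaban's three-tori -/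

section MeanAction

/-- **★ THE BARE STIFFNESS WITHOUT SLACK**: one absolute `E` with `∫ exp(c₀·β_K·Σ_a|U(∂a) − 1|²) dGibbs_K ≤ exp(E·#Plaq_0)` for every `F`,
`0 < γ ≤ 1`, `K`, `0 ≤ c₀ ≤ 1/8`. [folklore] -/
theorem exists_bareStiffness_le :
    ∃ E : ℝ, 0 ≤ E ∧ ∀ (F : T3Family) (γ : ℝ), 0 < γ → γ ≤ 1 → ∀ (K : ℕ) (c₀ : ℝ), 0 ≤ c₀ → c₀ ≤ 1 / 8 →
      ∫ U, Real.exp (c₀ * (γ * ((F.L : ℝ)⁻¹) ^ K)⁻¹ * ∑ a : Plaq (F.P K) 0, dist1 (GaugeField.plaqHol U a) ^ 2) ∂(gibbsK F ℰp γ K) ≤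
        Real.exp (E * (Fintype.card (Plaq (F.P K) 0) : ℝ)) := by
  obtain ⟨E, hE0, hE⟩ := log_partitionFn_ratio_le_exact
  refine ⟨E, hE0, fun F γ hγ hγ1 K c₀ hc₀ hc₀' => ?_⟩
  set β : ℝ := (γ * ((F.L : ℝ)⁻¹) ^ K)⁻¹ with hβdef
  set nP : ℝ := (Fintype.card (Plaq (F.P K) 0) : ℝ) with hnP
  have hβ1 : 1 ≤ β := by
    have hL1 : (1 : ℝ) ≤ F.L := by exact_mod_cast F.hL.2.le
    have hx0 : 0 < ((F.L : ℝ)⁻¹) ^ K := pow_pos (inv_pos.2 (by linarith)) K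
    have hx : ((F.L : ℝ)⁻¹) ^ K ≤ 1 := pow_le_one₀ (inv_nonneg.2 (by linarith)) (inv_le_one_of_one_le₀ hL1)
    exact (one_le_inv₀ (mul_pos hγ hx0)).2 (by nlinarith)
  have hβ0 : 0 < β := lt_of_lt_of_le one_pos hβ1
  haveI := isProbabilityMeasure_gibbsK F ℰp hγ.le K
  have hnP3 : nP = 3 * (Fintype.card (Site (F.P K) 0) : ℝ) := card_plaq_zero_eq F K
  have hV0 : (0 : ℝ) ≤ (Fintype.card (Site (F.P K) 0) : ℝ) := Nat.cast_nonneg _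
  -- pointwise `exp(c₀βΣd²) ≤ exp(tA)`, `t = 4c₀β ≤ β/2`
  set t : ℝ := 4 * c₀ * β with ht
  have ht0 : 0 ≤ t := by positivity
  have htβ : t ≤ β / 2 := by rw [ht]; nlinarith
  have hpt : ∀ U : GaugeField (F.P K) 0 (Matrix.specialUnitaryGroup (Fin 2) ℂ),
      Real.exp (c₀ * β * ∑ a : Plaq (F.P K) 0, dist1 (GaugeField.plaqHol U a) ^ 2) ≤ Real.exp (t * wilsonAction4 U) := fun U => by
    refine Real.exp_le_exp.mpr ?_
    have h4 := sqSum_le_four_mul_action F U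
    have hcb : 0 ≤ c₀ * β := by positivity
    calc c₀ * β * ∑ a : Plaq (F.P K) 0, dist1 (GaugeField.plaqHol U a) ^ 2 ≤ c₀ * β * (4 * wilsonAction4 U) :=
          mul_le_mul_of_nonneg_left h4 hcb
      _ = t * wilsonAction4 U := by rw [ht]; ring
  have hint : Integrable (fun U : GaugeField (F.P K) 0 (Matrix.specialUnitaryGroup (Fin 2) ℂ) => Real.exp (t * wilsonAction4 U))
      (gibbsK F ℰp γ K) := by
    refine integrable_of_bounded ((measurable_wilsonAction4 RegularGaugeGroup.measurable_reTr).const_mul _).exp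
      (M := Real.exp (t * (2 * nP))) fun U => ?_
    rw [abs_of_pos (Real.exp_pos _)]
    obtain ⟨h0, h2⟩ := wilsonAction4_mem U
    exact Real.exp_le_exp.mpr (mul_le_mul_of_nonneg_left h2 ht0)
  have hstep : ∫ U, Real.exp (c₀ * β * ∑ a : Plaq (F.P K) 0, dist1 (GaugeField.plaqHol U a) ^ 2) ∂(gibbsK F ℰp γ K) ≤
      partitionFn (G := Matrix.specialUnitaryGroup (Fin 2) ℂ) (F.P K) (β - t) /
        partitionFn (G := Matrix.specialUnitaryGroup (Fin 2) ℂ) (F.P K) β := by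
    calc ∫ U, Real.exp (c₀ * β * ∑ a : Plaq (F.P K) 0, dist1 (GaugeField.plaqHol U a) ^ 2) ∂(gibbsK F ℰp γ K)
        ≤ ∫ U, Real.exp (t * wilsonAction4 U) ∂(gibbsK F ℰp γ K) :=
          integral_mono_of_nonneg (ae_of_all _ fun U => (Real.exp_pos _).le) hint (ae_of_all _ hpt)
      _ = partitionFn (G := Matrix.specialUnitaryGroup (Fin 2) ℂ) (F.P K) (β - t) /
            partitionFn (G := Matrix.specialUnitaryGroup (Fin 2) ℂ) (F.P K) β := by
          rw [gibbsK_eq, scheme_β_eq]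
          exact integral_exp_mul_action_eq (F.P K) hβ0.le t
  -- the ratio WITHOUT slack
  have hβ'0 : 0 < β - t := by linarith
  have hββ' : β ≤ 2 * (β - t) := by linarith
  have hZ : 0 < partitionFn (G := Matrix.specialUnitaryGroup (Fin 2) ℂ) (F.P K) β := partitionFn_pos' (F.P K) hβ0.le
  have hZ' : 0 < partitionFn (G := Matrix.specialUnitaryGroup (Fin 2) ℂ) (F.P K) (β - t) := partitionFn_pos' (F.P K) hβ'0.le
  have hratio := hE (F.P K) (T3Family.P_d F K) β (β - t) hβ1 hβ'0 hββ'
  have hfin : Real.log (partitionFn (G := Matrix.specialUnitaryGroup (Fin 2) ℂ) (F.P K) (β - t)) -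
      Real.log (partitionFn (G := Matrix.specialUnitaryGroup (Fin 2) ℂ) (F.P K) β) ≤ E * nP := by
    rw [hnP3]
    have : E * (Fintype.card (Site (F.P K) 0) : ℝ) ≤ E * (3 * (Fintype.card (Site (F.P K) 0) : ℝ)) := by nlinarith
    linarith
  calc ∫ U, Real.exp (c₀ * β * ∑ a : Plaq (F.P K) 0, dist1 (GaugeField.plaqHol U a) ^ 2) ∂(gibbsK F ℰp γ K)
      ≤ partitionFn (G := Matrix.specialUnitaryGroup (Fin 2) ℂ) (F.P K) (β - t) /
          partitionFn (G := Matrix.specialUnitaryGroup (Fin 2) ℂ) (F.P K) β := hstep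
    _ = Real.exp (Real.log (partitionFn (G := Matrix.specialUnitaryGroup (Fin 2) ℂ) (F.P K) (β - t)) -
          Real.log (partitionFn (G := Matrix.specialUnitaryGroup (Fin 2) ℂ) (F.P K) β)) := by
        rw [Real.exp_sub, Real.exp_log hZ', Real.exp_log hZ]
    _ ≤ Real.exp (E * nP) := Real.exp_le_exp.mpr hfin

/-- **★★ THE UNIFORM MEAN ACTION**: one absolute `C` with `β_K·∫ Σ_a|U(∂a) − 1|² dGibbs_K ≤ C·#Plaq_0` for every `F`, `0 < γ ≤ 1`, `K`
(Jensen at `c₀ = 1/8`). [folklore] -/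
theorem exists_meanSqSum_le :
    ∃ C : ℝ, 0 ≤ C ∧ ∀ (F : T3Family) (γ : ℝ), 0 < γ → γ ≤ 1 → ∀ (K : ℕ),
      (γ * ((F.L : ℝ)⁻¹) ^ K)⁻¹ * ∫ U, (∑ a : Plaq (F.P K) 0, dist1 (GaugeField.plaqHol U a) ^ 2) ∂(gibbsK F ℰp γ K) ≤
        C * (Fintype.card (Plaq (F.P K) 0) : ℝ) := by
  obtain ⟨E, hE0, hE⟩ := exists_bareStiffness_le
  refine ⟨8 * E, by positivity, fun F γ hγ hγ1 K => ?_⟩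
  set β : ℝ := (γ * ((F.L : ℝ)⁻¹) ^ K)⁻¹ with hβdef
  have hβ0 : 0 ≤ β := inv_nonneg.2 (mul_nonneg hγ.le (pow_nonneg (inv_nonneg.2 (Nat.cast_nonneg _)) K))
  haveI := isProbabilityMeasure_gibbsK F ℰp hγ.le K
  have hb := hE F γ hγ hγ1 K (1 / 8) (by norm_num) le_rfl
  have hpos : 0 < ∫ U, Real.exp (1 / 8 * β * ∑ a : Plaq (F.P K) 0, dist1 (GaugeField.plaqHol U a) ^ 2) ∂(gibbsK F ℰp γ K) := by
    have hc : ∫ _U : GaugeField (F.P K) 0 (Matrix.specialUnitaryGroup (Fin 2) ℂ), (1 : ℝ) ∂(gibbsK F ℰp γ K) = 1 := by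
      rw [integral_const, smul_eq_mul, mul_one, probReal_univ]
    have h1 : ∫ _U : GaugeField (F.P K) 0 (Matrix.specialUnitaryGroup (Fin 2) ℂ), (1 : ℝ) ∂(gibbsK F ℰp γ K) ≤
        ∫ U, Real.exp (1 / 8 * β * ∑ a : Plaq (F.P K) 0, dist1 (GaugeField.plaqHol U a) ^ 2) ∂(gibbsK F ℰp γ K) := by
      refine integral_mono_of_nonneg (ae_of_all _ fun _ => zero_le_one) ?_ (ae_of_all _ fun U => ?_)
      · refine integrable_of_bounded (((measurable_sqSum F K).const_mul _).exp)
          (M := Real.exp (1 / 8 * β * (4 * (Fintype.card (Plaq (F.P K) 0) : ℝ)))) fun U => ?_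
        rw [abs_of_pos (Real.exp_pos _)]
        have hb8 : (0 : ℝ) ≤ 1 / 8 * β := by positivity
        exact Real.exp_le_exp.mpr (mul_le_mul_of_nonneg_left (sqSum_mem F U).2 hb8)
      · have hb8 : (0 : ℝ) ≤ 1 / 8 * β := by positivity
        exact Real.one_le_exp (mul_nonneg hb8 (sqSum_mem F U).1)
    rw [hc] at h1
    linarith
  have hJ : ∫ U, (1 / 8 * β * ∑ a : Plaq (F.P K) 0, dist1 (GaugeField.plaqHol U a) ^ 2) ∂(gibbsK F ℰp γ K) ≤
      Real.log (∫ U, Real.exp (1 / 8 * β * ∑ a : Plaq (F.P K) 0, dist1 (GaugeField.plaqHol U a) ^ 2) ∂(gibbsK F ℰp γ K)) :=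
    integral_le_log_integral_exp ((measurable_sqSum F K).const_mul _)
      (M := 1 / 8 * β * (4 * (Fintype.card (Plaq (F.P K) 0) : ℝ))) fun U => by
        obtain ⟨h0, h4⟩ := sqSum_mem F U
        rw [abs_of_nonneg (by positivity)]
        exact mul_le_mul_of_nonneg_left h4 (by positivity)
  have hlog := Real.log_le_log hpos hb
  rw [Real.log_exp] at hlog
  rw [integral_const_mul] at hJ
  linarith

end MeanAction

/-! ## §4 The registered stub BY NAME AND SIGNATURE -/

section Stub

/-- **REGISTERED STUB `stub_uniformMeanAction`** (S3) of the birth skeleton of crux `CappedCoarseStiffnessL` (stmt-QuantumFields-25301, skeleton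
`f0d56d8a…`), VERBATIM — **UNIFORM MEAN ACTION ON BAŁABAN's THREE-TORI**: for every `L` there are `C` and `γ₁ ∈ (0, 1]` (here `γ₁ = 1`) such
that for every `F` (`F.L = L`), `0 < γ ≤ γ₁` and EVERY cut-off `K`: `β_K·∫ Σ_a|U(∂a) − 1|² dGibbs_K ≤ C·#Plaq_0`.
[cite: Balaban1985UV3, (5) p.256 and (11) p.258] -/
theorem stub_uniformMeanAction :
    ∀ (L : ℕ), ∃ (C γ₁ : ℝ), 0 < γ₁ ∧ γ₁ ≤ 1 ∧ ∀ (F : T3Family) (γ : ℝ), F.L = L → 0 < γ → γ ≤ γ₁ → ∀ (K : ℕ),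
      (γ * ((F.L : ℝ)⁻¹) ^ K)⁻¹ * ∫ U, (∑ a : Plaq (F.P K) 0, dist1 (GaugeField.plaqHol U a) ^ 2) ∂(gibbsK F ℰp γ K) ≤
        C * (Fintype.card (Plaq (F.P K) 0) : ℝ) := by
  intro L
  obtain ⟨C, -, hC⟩ := exists_meanSqSum_le
  exact ⟨C, 1, one_pos, le_rfl, fun F γ _ hγ hγ1 K => hC F γ hγ hγ1 K⟩

end Stub

end Summit.QuantumFields.YangMills.Theorems.CoarseStiffnessTailUniformMeanAction

end
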